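import Literature.Geometry.Lorentzian.AdiabaticTracking
import Literature.Geometry.Lorentzian.AdiabaticTrackingWindows
import Literature.Geometry.Lorentzian.ApproximateKerrConfigurationReanchor
import Summits.FinalStateConjecture.FinalStateConjecture.Statement
import HarnessLib

/-!
# Crux `DriftCapture` (stmt-FinalStateConjecture-17391), stub `stub_flatLateChartOfTracking`:
# the `N = 0` seam IS a chain of `ε`-flat windows (bookkeeping brick for the flat-window gluing)

The registered stub `stub_flatLateChartOfTracking` (ASSEMBLE at `N = 0`) of the skeleton
`Summits/FinalStateConjecture/FinalStateConjecture/Cruxes/DriftCapture/Lines/birth.lean` consumes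
all-accuracy adiabatic tracking with NO hole, `𝒟.IsAdiabaticallyTracked 0 m₀ χ ε L R₀` for all
`L > 0`, `ε > 0`, `R₀`, and asks for ONE anchored flat late chart with `C²` deviation `→ 0` on entire
slabs (window-chart GLUING across accuracies; no tree API, see the lead's brief and
`Cruxes/RecurrentlyFlatDisperses/Lines/Sketch-dead.md` §3 (B)).

This file lands the bookkeeping that every attack on (and every audit of) that stub starts from:
with no hole, an `ε`-approximate `0`-Kerr configuration on the chart-time window `[τ, τ + L]` is
nothing but an `ε`-flat `C^k` window chart on an ENTIRE slab region `{x⁰ ∈ [τ, τ + L]} ⊆ U` with the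
causal trichotomy of `O` relative to its two boundary slabs
(`windowImage_eq_of_N_eq_zero`, `certifiedSlab_eq_of_N_eq_zero`, `setOf_mem_Icc_subset_flatDomain`,
`diff_radiationZone_subset_of_N_eq_zero`), and the `N = 0` seam is EQUIVALENT to a chain of such
flat windows — chained, exhausting, pinned, covered — in which the mass floor `m₀`, the spin bound
`χ` and the radius floor `R₀` do not occur (`isAdiabaticallyTracked_zero_iff_flatWindows`); in
particular `N = 0` tracking is independent of `(m₀, χ, R₀)`
(`isAdiabaticallyTracked_zero_iff_of_zero`). Audit consequence (recorded for the lead, informal): the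
stub's hypothesis is satisfiable in the intended model (Minkowski `ℝ⁴` as MGHD of trivial data, windows
`{t ∈ [nL, (n + 1)L]}`, `O = {t ≥ 0}`), so it is not refutable from the clause list, and its
conclusion is honest (`deviationCk … 2 τ → 0` contains `sup ‖Φ^* g − η‖ → 0` over the ENTIRE slabs
`{x⁰ = τ} ≅ ℝ³`, `τ > τ₁`, which no squeezed or re-timed single window and no collapsed map meets).

Mathlib + the Literature seam files only; no definitions, no named facts, no `sorry`.

References: Klainerman, C. R. Mécanique 353 (2025), §1.1.1, §2.3; DHRT arXiv:2104.08222, §1;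
Christodoulou–Klainerman 1993, Thm. 1.0.2 (dispersal, shape of the `N = 0` conclusion).
-/

-- the doubled `FinalStateConjecture.FinalStateConjecture` path component trips dupNamespace
set_option linter.dupNamespace false

noncomputable section

namespace Summit.FinalStateConjecture.FinalStateConjecture.Theorems.RenormalisedDrift.DriftCapture

open Set Filter Topology
open scoped Manifold ContDiff ENNReal
open Literature.Geometry.Lorentzian

universe u

/-! ### A `0`-hole configuration is a flat window -/

section Config

variable {𝓢 : Spacetime.{u} 4} {O : Set 𝓢.carrier} {k : ℕ} {ε : ℝ≥0∞} {τ L R : ℝ}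

/-- With no hole, the certified window image of an `ε`-approximate configuration is its radiation
zone: the flat chart's image of the flat window `{x⁰ ∈ [τ, τ + L]} ∩ U₀`. [folklore] -/
theorem windowImage_eq_of_N_eq_zero (c : ApproximateKerrConfiguration 𝓢 O k ε τ L R)
    (hN : c.N = 0) :
    c.windowImage = c.flatChart '' (Minkowski.backgroundOn c.flatDomain).window τ L := by
  haveI : IsEmpty (Fin c.N) := ⟨fun i ↦ (i.cast hN).elim0⟩
  rw [ApproximateKerrConfiguration.windowImage, iUnion_of_empty, union_empty]
  rfl

/-- With no hole, the certified slab at chart time `σ` is the flat chart's image of the flat slab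
`{x⁰ = σ} ∩ U₀`. [folklore] -/
theorem certifiedSlab_eq_of_N_eq_zero (c : ApproximateKerrConfiguration 𝓢 O k ε τ L R)
    (hN : c.N = 0) (σ : ℝ) :
    c.certifiedSlab σ = c.flatChart '' (Minkowski.backgroundOn c.flatDomain).timeSlab σ := by
  haveI : IsEmpty (Fin c.N) := ⟨fun i ↦ (i.cast hN).elim0⟩
  rw [ApproximateKerrConfiguration.certifiedSlab, iUnion_of_empty, union_empty]
  rfl

/-- With no hole, the flat domain contains the ENTIRE window slab `{x⁰ ∈ [τ, τ + L]}` (no tube is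
excised). [folklore] -/
theorem setOf_mem_Icc_subset_flatDomain (c : ApproximateKerrConfiguration 𝓢 O k ε τ L R)
    (hN : c.N = 0) : {x : E4 | x 0 ∈ Icc τ (τ + L)} ⊆ (c.flatDomain : Set E4) :=
  fun _ hx ↦ c.setOf_lt_excision_subset_flatDomain ⟨hx, fun i ↦ (i.cast hN).elim0⟩

/-- With no hole, the covering clause is the causal trichotomy of `O` relative to the flat window:
every point of `O` off the radiation zone lies causally below the flat slab at `τ` or causally above
the flat slab at `τ + L`. [folklore] -/
theorem diff_radiationZone_subset_of_N_eq_zero (c : ApproximateKerrConfiguration 𝓢 O k ε τ L R)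
    (hN : c.N = 0) :
    O \ c.flatChart '' (Minkowski.backgroundOn c.flatDomain).window τ L ⊆
      𝓢.metric.causalPast 𝓢.timeOrientation
          (c.flatChart '' (Minkowski.backgroundOn c.flatDomain).timeSlab τ) ∪
        𝓢.metric.causalFuture 𝓢.timeOrientation
          (c.flatChart '' (Minkowski.backgroundOn c.flatDomain).timeSlab (τ + L)) := by
  have h := c.diff_windowImage_subset
  rwa [windowImage_eq_of_N_eq_zero c hN, certifiedSlab_eq_of_N_eq_zero c hN,
    certifiedSlab_eq_of_N_eq_zero c hN] at h

end Config

/-! ### The `N = 0` seam in flat-window form -/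

section Seam

/-- **The `N = 0` seam is a chain of `ε`-flat windows.** A vacuum Cauchy development `𝒟` is
adiabatically tracked with NO hole at accuracy `(ε, L, R₀)` (any mass floor `m₀`, spin bound `χ`)
iff it carries a region `O`, flat domains `Uₙ ⊇ {x⁰ ∈ [0, L]}` and flat charts `φₙ : Uₙ → 𝒟` which
are window charts into `O` for the flat windows `{x⁰ ∈ [0, L]} ∩ Uₙ` (smooth, open embeddings near
the window, window image in `O`) with full `C²` deviation from `η` at most `ε` on every flat slab
`{x⁰ = σ} ∩ Uₙ`, `σ ∈ [0, L]`, and the causal trichotomy `O ∖ φₙ(window) ⊆ J⁻(φₙ{x⁰ = 0}) ∪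
J⁺(φₙ{x⁰ = L})`, such that the windows are CHAINED (`φₙ₊₁{x⁰ = 0} ⊆ φₙ(window)`), EXHAUST (leave the
causal past of every compact set), PIN `O = J⁺(ι X) ∩ I⁻(⋃ₙ φₙ(window))` and COVER
(`O ⊆ J⁻(φ₀{x⁰ = 0}) ∪ ⋃ₙ φₙ(window)`). The radii `Rₙ`, `m₀`, `χ`, `R₀` of the seam constrain only
holes, so they disappear (backwards: `Rₙ := R₀ + n`). Klainerman, C. R. Mécanique 353 (2025), §1.1.1
(`N = 0`: "a radiative decaying term" only); DHRT arXiv:2104.08222, §1. Registered sub-goal of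
crux stmt-FinalStateConjecture-17391 (one-line header = registered signature). [folklore] -/
theorem isAdiabaticallyTracked_zero_iff_flatWindows : ∀ {X : Type} [TopologicalSpace X] [ChartedSpace E3 X] [IsManifold (𝓡 3) ((⊤ : ℕ∞) : WithTop ℕ∞) X] [ConnectedSpace X] {D : InitialDataSet (𝓡 3) X} (𝒟 : VacuumCauchyDevelopment D) (m₀ χ : ℝ) (ε : ENNReal) (L R₀ : ℝ), 𝒟.IsAdiabaticallyTracked 0 m₀ χ ε L R₀ ↔ ∃ (O : Set 𝒟.carrier) (U : ℕ → TopologicalSpace.Opens E4) (φ : ∀ n, U n → 𝒟.carrier), (∀ n, {x : E4 | x 0 ∈ Set.Icc 0 L} ⊆ (U n : Set E4)) ∧ (∀ n, 𝒟.toSpacetime.IsWindowChart (Minkowski.backgroundOn (U n)) O ((Minkowski.backgroundOn (U n)).window 0 L) (φ n)) ∧ (∀ n, ∀ σ ∈ Set.Icc 0 L, 𝒟.toSpacetime.deviationCk (Minkowski.backgroundOn (U n)) (φ n) 2 σ ≤ ε) ∧ (∀ n, O \ φ n '' (Minkowski.backgroundOn (U n)).window 0 L ⊆ 𝒟.metric.causalPast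 𝒟.timeOrientation (φ n '' (Minkowski.backgroundOn (U n)).timeSlab 0) ∪ 𝒟.metric.causalFuture 𝒟.timeOrientation (φ n '' (Minkowski.backgroundOn (U n)).timeSlab L)) ∧ (∀ n, φ (n + 1) '' (Minkowski.backgroundOn (U (n + 1))).timeSlab 0 ⊆ φ n '' (Minkowski.backgroundOn (U n)).window 0 L) ∧ (∀ K : Set 𝒟.carrier, IsCompact K → ∃ n₀ : ℕ, ∀ n, n₀ ≤ n → Disjoint (φ n '' (Minkowski.backgroundOn (U n)).window 0 L) (𝒟.metric.causalPast 𝒟.timeOrientation K)) ∧ O = 𝒟.toCauchyDevelopment.exteriorOf (⋃ n, φ n '' (Minkowski.backgroundOn (U n)).window 0 L) ∧ O ⊆ 𝒟.metric.causalPast 𝒟.timeOrientation (φ 0 '' (Minkowski.backgroundOn (U 0)).timeSlab 0) ∪ ⋃ n, φ n '' (Minkowski.backgroundOn (U n)).window 0 L := by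
  intro X _ _ _ _ D 𝒟 m₀ χ ε L R₀
  constructor
  · rintro ⟨R, O, c, -, -, hN, -, hch, hex, hO, hcov⟩
    have hW : ∀ n, (c n).windowImage =
        (c n).flatChart '' (Minkowski.backgroundOn (c n).flatDomain).window 0 L :=
      fun n ↦ windowImage_eq_of_N_eq_zero (c n) (hN n)
    have hS : ∀ n σ, (c n).certifiedSlab σ =
        (c n).flatChart '' (Minkowski.backgroundOn (c n).flatDomain).timeSlab σ :=
      fun n σ ↦ certifiedSlab_eq_of_N_eq_zero (c n) (hN n) σ
    refine ⟨O, fun n ↦ (c n).flatDomain, fun n ↦ (c n).flatChart, fun n x hx ↦ ?_,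
      fun n ↦ (c n).isWindowChart_flat, fun n σ hσ ↦ ?_, fun n ↦ ?_, fun n ↦ ?_,
      fun K hK ↦ ?_, ?_, ?_⟩
    · exact setOf_mem_Icc_subset_flatDomain (c n) (hN n) (by rwa [zero_add])
    · exact (c n).deviationCk_flat_le σ (by rwa [zero_add])
    · have h := diff_radiationZone_subset_of_N_eq_zero (c n) (hN n)
      rwa [zero_add] at h
    · rw [← hW n, ← hS (n + 1) 0]
      exact hch n
    · obtain ⟨n₀, hn₀⟩ := hex K hK
      exact ⟨n₀, fun n hn ↦ by rw [← hW n]; exact hn₀ n hn⟩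
    · rw [iUnion_congr fun n ↦ (hW n).symm]
      exact hO
    · rw [← hS 0 0, iUnion_congr fun n ↦ (hW n).symm]
      exact hcov
  · rintro ⟨O, U, φ, hU, hφ, hdev, htri, hch, hex, hO, hcov⟩
    -- the `0`-hole configurations of the chain (every hole field over `Fin 0`)
    let c : ∀ n : ℕ, ApproximateKerrConfiguration 𝒟.toSpacetime O 2 ε 0 L (R₀ + n) := fun n ↦
      { N := 0
        mass := Fin.elim0
        spin := Fin.elim0
        mass_pos := fun i ↦ i.elim0
        isSubextremal := fun i ↦ i.elim0
        motion := Fin.elim0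
        chart := fun i ↦ i.elim0
        isWindowChart := fun i ↦ i.elim0
        truncDeviationCk_le := fun i ↦ i.elim0
        pairwise_disjoint := fun i ↦ i.elim0
        excision := Fin.elim0
        excision_le := fun i ↦ i.elim0
        flatDomain := U n
        setOf_lt_excision_subset_flatDomain := fun x hx ↦ hU n (by
          have h := hx.1
          rwa [zero_add] at h)
        flatChart := φ n
        isWindowChart_flat := hφ n
        deviationCk_flat_le := fun σ hσ ↦ hdev n σ (by rwa [zero_add] at hσ)
        diff_subset := by
          rw [iUnion_of_empty, iUnion_of_empty, iUnion_of_empty, union_empty, union_empty,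
            union_empty, zero_add]
          exact htri n }
    have hN : ∀ n, (c n).N = 0 := fun _ ↦ rfl
    have hW : ∀ n, (c n).windowImage = φ n '' (Minkowski.backgroundOn (U n)).window 0 L :=
      fun n ↦ windowImage_eq_of_N_eq_zero (c n) (hN n)
    have hS : ∀ n σ, (c n).certifiedSlab σ = φ n '' (Minkowski.backgroundOn (U n)).timeSlab σ :=
      fun n σ ↦ certifiedSlab_eq_of_N_eq_zero (c n) (hN n) σ
    refine ⟨fun n ↦ R₀ + n, O, c, fun n ↦ le_add_of_nonneg_right n.cast_nonneg,
      tendsto_atTop_add_const_left _ _ tendsto_natCast_atTop_atTop, hN, fun n i ↦ i.elim0,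
      fun n ↦ ?_, fun K hK ↦ ?_, ?_, ?_⟩
    · rw [hS (n + 1) 0, hW n]
      exact hch n
    · obtain ⟨n₀, hn₀⟩ := hex K hK
      exact ⟨n₀, fun n hn ↦ by rw [hW n]; exact hn₀ n hn⟩
    · rw [iUnion_congr hW]
      exact hO
    · rw [hS 0 0, iUnion_congr hW]
      exact hcov

variable {X : Type} [TopologicalSpace X] [ChartedSpace E3 X] [IsManifold (𝓡 3) ∞ X]
  [ConnectedSpace X] {D : InitialDataSet (𝓡 3) X}

/-- **`N = 0` tracking does not see `(m₀, χ, R₀)`.** With no hole the complexity bounds and the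
radius floor constrain nothing: tracking at `(0, m₀, χ, ε, L, R₀)` is tracking at
`(0, m₀', χ', ε, L, R₀')`. [folklore] -/
theorem isAdiabaticallyTracked_zero_iff_of_zero (𝒟 : VacuumCauchyDevelopment D)
    (m₀ χ m₀' χ' : ℝ) (ε : ℝ≥0∞) (L R₀ R₀' : ℝ) :
    𝒟.IsAdiabaticallyTracked 0 m₀ χ ε L R₀ ↔ 𝒟.IsAdiabaticallyTracked 0 m₀' χ' ε L R₀' :=
  (isAdiabaticallyTracked_zero_iff_flatWindows 𝒟 m₀ χ ε L R₀).trans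
    (isAdiabaticallyTracked_zero_iff_flatWindows 𝒟 m₀' χ' ε L R₀').symm

/-- **The hypothesis of `stub_flatLateChartOfTracking` in flat-window form.** All-accuracy tracking
with no hole (`∀ L > 0, ∀ ε > 0, ∀ R₀, 𝒟.IsAdiabaticallyTracked 0 m₀ χ ε L R₀`, the stub's tracking
hypothesis verbatim) is: for every window length `L > 0` and every accuracy `ε > 0`, a chained,
exhausting, pinned, covered chain of `ε`-flat `C²` windows on entire slab regions `{x⁰ ∈ [0, L]}`
(the right-hand side of `isAdiabaticallyTracked_zero_iff_flatWindows`). This is the exact input of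
the flat-window gluing the stub asks for. [folklore] -/
theorem allAccuracy_zero_iff_flatWindows (𝒟 : VacuumCauchyDevelopment D) (m₀ χ : ℝ) :
    (∀ (L : ℝ) (ε : ℝ≥0∞) (R₀ : ℝ), 0 < L → 0 < ε → 𝒟.IsAdiabaticallyTracked 0 m₀ χ ε L R₀) ↔
      ∀ (L : ℝ) (ε : ℝ≥0∞), 0 < L → 0 < ε →
        ∃ (O : Set 𝒟.carrier) (U : ℕ → TopologicalSpace.Opens E4) (φ : ∀ n, U n → 𝒟.carrier),
          (∀ n, {x : E4 | x 0 ∈ Icc 0 L} ⊆ (U n : Set E4)) ∧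
          (∀ n, 𝒟.toSpacetime.IsWindowChart (Minkowski.backgroundOn (U n)) O
            ((Minkowski.backgroundOn (U n)).window 0 L) (φ n)) ∧
          (∀ n, ∀ σ ∈ Icc 0 L,
            𝒟.toSpacetime.deviationCk (Minkowski.backgroundOn (U n)) (φ n) 2 σ ≤ ε) ∧
          (∀ n, O \ φ n '' (Minkowski.backgroundOn (U n)).window 0 L ⊆
            𝒟.metric.causalPast 𝒟.timeOrientation
                (φ n '' (Minkowski.backgroundOn (U n)).timeSlab 0) ∪
              𝒟.metric.causalFuture 𝒟.timeOrientation
                (φ n '' (Minkowski.backgroundOn (U n)).timeSlab L)) ∧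
          (∀ n, φ (n + 1) '' (Minkowski.backgroundOn (U (n + 1))).timeSlab 0 ⊆
            φ n '' (Minkowski.backgroundOn (U n)).window 0 L) ∧
          (∀ K : Set 𝒟.carrier, IsCompact K → ∃ n₀ : ℕ, ∀ n, n₀ ≤ n →
            Disjoint (φ n '' (Minkowski.backgroundOn (U n)).window 0 L)
              (𝒟.metric.causalPast 𝒟.timeOrientation K)) ∧
          O = 𝒟.toCauchyDevelopment.exteriorOf
            (⋃ n, φ n '' (Minkowski.backgroundOn (U n)).window 0 L) ∧
          O ⊆ 𝒟.metric.causalPast 𝒟.timeOrientation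
              (φ 0 '' (Minkowski.backgroundOn (U 0)).timeSlab 0) ∪
            ⋃ n, φ n '' (Minkowski.backgroundOn (U n)).window 0 L := by
  constructor
  · intro h L ε hL hε
    exact (isAdiabaticallyTracked_zero_iff_flatWindows 𝒟 m₀ χ ε L 0).1 (h L ε 0 hL hε)
  · intro h L ε R₀ hL hε
    exact (isAdiabaticallyTracked_zero_iff_flatWindows 𝒟 m₀ χ ε L R₀).2 (h L ε hL hε)

end Seam

end Summit.FinalStateConjecture.FinalStateConjecture.Theorems.RenormalisedDrift.DriftCapture

end
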